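import Mathlib
import HarnessLib
import Summits.HubbardSuperconductivity.HubbardSuperconductivity.Theorems.WeakCouplingBCSKlSelectionWindowRows

/-!
# Route `WeakCouplingBCS` — channel-margin lane of `WcbcsKohnLuttingerB1g` (stmt-HubbardSuperconductivity-0158):
# `B1g` selection to ALL orders for EVERY remainder constant `C ≥ C4` — the explicit threshold `U₀(C)`

Every explicit-`U₀` row of the lane (`KLU0Row`, `Theorems/WeakCouplingBCSDefsKlU0Record.lean`; the window rows `KLU0WinRow` of
`…DefsKlU0Window*.lean`) carries an ASSUMED constant `C4` (`= 10` in every window row): a form bound, per `U⁴`, of the non-chain part of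
order `≥ 4` of the particle–particle-irreducible Cooper vertex `Γ_U` — the one datum of the rows that is NOT certified (it is the output the
constructive programme owes; cell file U0-TABLE.md v4 §D (iv)).  The all-orders theorems landed so far (`klAllOrders_selection*`,
`Theorems/WeakCouplingBCSKlAllOrdersSelection.lean`, `…SelectionWindow*.lean`) read that column literally: «for every remainder kernel whose
form is bounded by `C4 = 10` …, selection for `0 < U ≤ u`».

This file removes the dependence on the VALUE of `C4`.  For a row passing `KLU0Row.ok` (endpoint inequality at `U0` with the row's own
`C4`) and ANY real `C ≥ C4`, the row inequality with `C` in place of `C4`,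
`rhohi + U(c3B+tB) + U²(c4B+C) < low - U(s3+t) - U²(s4+C)`,
holds for every `0 < U ≤ U0` satisfying the explicit smallness condition
`2 (C - C4) U² U0 ≤ (U0 - U) (low - rhohi)`            (⋆)
— in particular for every `U ≤ U0/2` with `4 (C - C4) U² ≤ low - rhohi`, i.e. `U ≤ min (U0/2, ½ √((low - rhohi)/(C - C4)))`.
PROOF (no new numerics): the gap `h(U) = (low - rhohi) - U a - U² b` of the row (`b ≥ 0`) is concave with `h(0) = low - rhohi > 0` and
`h(U0) > 0` (the kernel-checked endpoint), so it lies above its chord: `U0 · h(U) = (U0 - U) h(0) + U h(U0) + U0 U (U0 - U) b > (U0 - U)(low - rhohi)`;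
(⋆) is exactly what absorbs the extra `2 (C - C4) U²`.  Consequences, all modulo the SAME named hypotheses as the `C4 = 10` theorems
(second-order `EnclosuresB1g` of the record boxes, the rows' named resummed window hypotheses) and with the remainder bounds now POINTWISE in
`U` (a kernel `R` with `⟨Φ_B, R Φ_B⟩ ≤ C ‖Φ_B‖²` on the record trial and `⟨φ, R φ⟩ ≥ -C` on normalised competitor states, at the coupling `U` at
hand — nothing is asked on `(0, U1]`):
* `klU0Row_sound_of_C4_le`, `klto_row_allOrders_of_C4_le` — row level, (⋆);
* `klAllOrdersC_bounds`, `klAllOrdersC_selection_of_lower`, `klAllOrdersC_selectionD` — one box of a second-order record;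
* `klAllOrdersC_selection_windowRows` — generic window of rows: rows passing `klU0WinCheck mub mua u`, common `C4 = C4₀`, and a
  kernel-decidable uniform gap `γ₀ ≤ low_χ - rhohi` on every row ⟹ for every `μ ∈ [mub, mua]`, every `C ≥ C4₀` and every
  `0 < U ≤ u` with `2 (C - C4₀) U² u ≤ (u - U) γ₀`: `B1g` selection in `resummedForm + U²⟨·, R ·⟩` for every such `R`;
  `klAllOrdersC_selection_windowRows_half` — the same for `2U ≤ u`, `4 (C - C4₀) U² ≤ γ₀`.
The instances on the lane's windows of record (V4 rows on `μ([0.10, 0.20])`, the 222-row join on `μ([0.10, 0.35])`) are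
`Theorems/WeakCouplingBCSKlAllOrdersSelectionAnyC4Window.lean`.

Honest framing: NOTHING here certifies a remainder bound — the theorems stay conditional on the displayed remainder hypotheses, whose
EXISTENCE (some finite `C`) is the constructive programme's theorem half; what changes is that the certificate layer now composes with ANY
such constant through an explicit `U₀(C) > 0`, instead of the assumed value `10`.  Existence-grade thresholds; no new definition, no new number
is certified here; nothing in this file asserts a pairing instability or superconductivity.  Cell file: U0-TABLE.md v4.1 (gate-hubbard-kl, margin-1 g12).

References: S. Raghu, S. A. Kivelson, D. J. Scalapino, Phys. Rev. B 81 (2010) 224505, App. A; D. J. Scalapino, E. Loh, J. E. Hirsch,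
Phys. Rev. B 34 (1986) 8190, (3)–(4).
-/

noncomputable section

-- the tree's namespace `Summit.<Summit>.<Problem>.Theorems` repeats the summit name by design (D-0017)
set_option linter.dupNamespace false

namespace Summit.HubbardSuperconductivity.HubbardSuperconductivity.Theorems

open MeasureTheory Literature.MathematicalPhysics.QuantumLattice CwKLChiralWindow KlThirdOrder

/-! ### Elementary inequalities -/

/-- **Chord bound ⇒ the smallness condition absorbs the extra remainder.**  If `γ > 0`… more precisely: if `0 < U ≤ U₀`, `0 ≤ b`,
the endpoint `γ - U₀ a - U₀² b > 0` holds and `2 K U₀ ≤ (U₀ - U) γ` (`K` = the extra `U²`-coefficient mass, here `(C - C4) U²`), then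
`γ - U a - U² b - 2 K > 0`.  (The concave `h(U) = γ - U a - U² b` lies above its chord.) [folklore] -/
theorem klU0_chord_absorb {γ a b U₀ U K : ℝ} (hb : 0 ≤ b) (h0 : 0 < γ - U₀ * a - U₀ ^ 2 * b)
    (hU : 0 < U) (hUU : U ≤ U₀) (hK : 2 * K * U₀ ≤ (U₀ - U) * γ) : 0 < γ - U * a - U ^ 2 * b - 2 * K := by
  have hU₀ : 0 < U₀ := lt_of_lt_of_le hU hUU
  have h2 : 0 < U * (γ - U₀ * a - U₀ ^ 2 * b) := mul_pos hU h0
  have h3 : 0 ≤ U₀ * (U * (U₀ - U) * b) :=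
    mul_nonneg hU₀.le (mul_nonneg (mul_nonneg hU.le (sub_nonneg.mpr hUU)) hb)
  have key : U₀ * (γ - U * a - U ^ 2 * b - 2 * K) =
      (U₀ - U) * γ + U * (γ - U₀ * a - U₀ ^ 2 * b) + U₀ * (U * (U₀ - U) * b) - 2 * K * U₀ := by
    ring
  have h4 : 0 < U₀ * (γ - U * a - U ^ 2 * b - 2 * K) := by rw [key]; linarith
  exact (mul_pos_iff_of_pos_left hU₀).mp h4

/-- **The halved form of the smallness condition**: `0 ≤ U`, `2U ≤ U₀`, `0 ≤ γ` and `4 (C - C4) U² ≤ γ` imply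
`2 (C - C4) U² U₀ ≤ (U₀ - U) γ`. [folklore] -/
theorem klU0_smallness_of_half {C C4 U U₀ γ : ℝ} (hU : 0 ≤ U) (hUU : 2 * U ≤ U₀) (hg0 : 0 ≤ γ)
    (hγ : 4 * (C - C4) * U ^ 2 ≤ γ) : 2 * (C - C4) * U ^ 2 * U₀ ≤ (U₀ - U) * γ := by
  have hU₀ : 0 ≤ U₀ := by linarith
  have h1 : U₀ / 2 * γ ≤ (U₀ - U) * γ := mul_le_mul_of_nonneg_right (by linarith) hg0
  have h2 : U₀ / 2 * (4 * (C - C4) * U ^ 2) ≤ U₀ / 2 * γ := mul_le_mul_of_nonneg_left hγ (by linarith)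
  have h3 : U₀ / 2 * (4 * (C - C4) * U ^ 2) = 2 * (C - C4) * U ^ 2 * U₀ := by ring
  linarith

/-- **Monotonicity of the smallness condition** (window ⇒ row): if it holds with the window's uniform threshold `u ≤ U₀` (`U ≤ u`) and
uniform gap `0 ≤ γ₀ ≤ γ`, it holds with the row's own `U₀` and gap `γ`. [folklore] -/
theorem klU0_smallness_mono {C C4 U u U₀ γ₀ γ : ℝ} (hU : 0 ≤ U) (hUu : U ≤ u) (hu : 0 < u) (huU : u ≤ U₀) (hγ₀ : 0 ≤ γ₀)
    (hγ : γ₀ ≤ γ) (h : 2 * (C - C4) * U ^ 2 * u ≤ (u - U) * γ₀) :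
    2 * (C - C4) * U ^ 2 * U₀ ≤ (U₀ - U) * γ := by
  have hU₀ : 0 ≤ U₀ := le_trans hu.le huU
  -- `(u - U) γ₀ U₀ ≤ u (U₀ - U) γ₀ ≤ u (U₀ - U) γ`
  have h1 : (u - U) * U₀ ≤ u * (U₀ - U) := by nlinarith
  have h2 : (u - U) * γ₀ * U₀ ≤ u * ((U₀ - U) * γ) := by
    calc (u - U) * γ₀ * U₀ = ((u - U) * U₀) * γ₀ := by ring
      _ ≤ (u * (U₀ - U)) * γ₀ := mul_le_mul_of_nonneg_right h1 hγ₀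
      _ = u * ((U₀ - U) * γ₀) := by ring
      _ ≤ u * ((U₀ - U) * γ) :=
          mul_le_mul_of_nonneg_left (mul_le_mul_of_nonneg_left hγ (by linarith)) hu.le
  have h3 : u * (2 * (C - C4) * U ^ 2 * U₀) ≤ u * ((U₀ - U) * γ) := by
    calc u * (2 * (C - C4) * U ^ 2 * U₀) = (2 * (C - C4) * U ^ 2 * u) * U₀ := by ring
      _ ≤ ((u - U) * γ₀) * U₀ := mul_le_mul_of_nonneg_right h hU₀
      _ = (u - U) * γ₀ * U₀ := by ring
      _ ≤ u * ((U₀ - U) * γ) := h2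
  exact le_of_mul_le_mul_left h3 hu

/-! ### Row level: the row inequality with an arbitrary remainder constant `C ≥ C4` -/

/-- **Soundness of a row for every remainder constant `C`.**  If `r.ok = true`, `c ∈ r.chans`, `C` is ANY real (of interest: `C ≥ r.C4`;
for `C ≤ C4` the condition below is void and the statement is weaker than `klU0Row_sound`), and reals `lamB, lamX` obey AT the coupling `U` the
row's upper / lower expansions with `C` in place of `C4`, then `lamB < lamX` — for every `0 < U ≤ U0` satisfying
`2 (C - C4) U² U0 ≤ (U0 - U)(low - rhohi)`. [folklore] -/
theorem klU0Row_sound_of_C4_le (r : KLU0Row) (hr : r.ok = true) (c : KLU0Chan) (hc : c ∈ r.chans)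
    (C U : ℝ) (hU : 0 < U) (hUU : U ≤ r.U0)
    (hsmall : 2 * (C - r.C4) * U ^ 2 * r.U0 ≤ ((r.U0 : ℝ) - U) * ((c.low : ℝ) - r.rhohi))
    (lamB lamX : ℝ)
    (hB : lamB ≤ r.rhohi + U * (r.c3B + r.tB) + U ^ 2 * (r.c4B + C))
    (hχ : (c.low : ℝ) - U * (c.s3 + c.t) - U ^ 2 * (c.s4 + C) ≤ lamX) :
    lamB < lamX := by
  have hr' := hr
  simp only [KLU0Row.ok, KLU0Row.endpoint, Bool.and_eq_true, decide_eq_true_eq, List.all_eq_true] at hr'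
  obtain ⟨⟨⟨⟨-, -⟩, hc4⟩, hC4⟩, hall⟩ := hr'
  obtain ⟨⟨-, hs4⟩, hend⟩ := hall c hc
  have hb : (0 : ℝ) ≤ ((c.s4 : ℝ) + r.C4) + (r.c4B + r.C4) := by
    have h1 : (0 : ℝ) ≤ c.s4 := by exact_mod_cast hs4
    have h2 : (0 : ℝ) ≤ r.c4B := by exact_mod_cast hc4
    have h3 : (0 : ℝ) ≤ r.C4 := by exact_mod_cast hC4
    linarith
  have hend' : (r.rhohi : ℝ) + r.U0 * (r.c3B + r.tB) + ((r.U0 : ℝ) * (r.U0 : ℝ)) * (r.c4B + r.C4) <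
      (c.low : ℝ) - r.U0 * (c.s3 + c.t) - ((r.U0 : ℝ) * (r.U0 : ℝ)) * (c.s4 + r.C4) := by exact_mod_cast hend
  have h0 : (0 : ℝ) < ((c.low : ℝ) - r.rhohi) - (r.U0 : ℝ) * (((c.s3 : ℝ) + c.t) + (r.c3B + r.tB)) -
      (r.U0 : ℝ) ^ 2 * (((c.s4 : ℝ) + r.C4) + (r.c4B + r.C4)) := by rw [sq]; linarith
  have hmain := klU0_chord_absorb (K := (C - r.C4) * U ^ 2) hb h0 hU hUU (by linarith [hsmall])
  nlinarith [hmain, sq_nonneg U]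

/-- **A row to all orders with remainder constant `C`** (any real): for `0 < U ≤ U0` with `2 (C - C4) U² U0 ≤ (U0 - U)(low - rhohi)`,
`rhohi + U(c3B+tB) + U²(c4B+C) < low - U(s3+t) - U²(s4+C)`. [folklore] -/
theorem klto_row_allOrders_of_C4_le (r : KLU0Row) (hr : r.ok = true) (c : KLU0Chan) (hc : c ∈ r.chans)
    (C U : ℝ) (hU : 0 < U) (hUU : U ≤ r.U0)
    (hsmall : 2 * (C - r.C4) * U ^ 2 * r.U0 ≤ ((r.U0 : ℝ) - U) * ((c.low : ℝ) - r.rhohi)) :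
    (r.rhohi : ℝ) + U * ((r.c3B : ℝ) + r.tB) + U ^ 2 * ((r.c4B : ℝ) + C) <
      (c.low : ℝ) - U * ((c.s3 : ℝ) + c.t) - U ^ 2 * ((c.s4 : ℝ) + C) :=
  klU0Row_sound_of_C4_le r hr c hc C U hU hUU hsmall _ _ le_rfl le_rfl

/-! ### One box of a second-order record: two-sided bounds and selection, remainder bounds POINTWISE in `U` -/

/-- **Two-sided bounds to all orders, remainder constant free.**  As `klAllOrders_bounds`, but the remainder enters POINTWISE: the
normalised `B1g` trial `ψ_B` (fixed by the box and `μ`) obeys, at every `0 < U ≤ U1` and for EVERY kernel `R` and real `C` with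
`⟨Φ_B, R Φ_B⟩ ≤ C ‖Φ_B‖²`, `resummedForm U ψ_B + U² ⟨ψ_B, R ψ_B⟩ ≤ rhohi + U(c3B+tB) + U²(c4B+C)`; every normalised competitor state `φ` with
`⟨φ, R φ⟩ ≥ -C` obeys `low - U(s3+t) - U²(s4+C) ≤ resummedForm U φ + U² ⟨φ, R φ⟩`. [folklore] -/
theorem klAllOrdersC_bounds {μ : ℝ} (hμ : μ ∈ Set.Ioo (-4 : ℝ) 0) (bx : KLBox) (tab : List KLTrig)
    (hritz : bx.bB1g.ritzOK tab D4Irrep.B1g = true) (hER : bx.bB1g.RitzEnclosure tab μ)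
    (hlower : ∀ χ : D4Irrep, χ ≠ D4Irrep.B1g →
      (((bx.blk χ).lower tab χ : ℚ) : ℝ) ≤ channelInf (squareDispersion 1 0) μ 1 χ)
    (r : KLU0Row) (hdom : r.dominates bx tab = true)
    (h3 : r.ResummedEnclosures μ (bx.bB1g.trialFun tab)) :
    ∃ ψ : Momentum → ℝ, IsChannelState (squareDispersion 1 0) μ D4Irrep.B1g ψ ∧
      (∀ U : ℝ, 0 < U → U ≤ r.U1 → ∀ (R : Momentum → Momentum → ℝ) (C : ℝ),
        kform (fermiCurveMeasure (squareDispersion 1 0) μ) R (bx.bB1g.trialFun tab) ≤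
            C * ∫ k, bx.bB1g.trialFun tab k ^ 2 ∂fermiCurveMeasure (squareDispersion 1 0) μ →
          resummedForm (squareDispersion 1 0) μ U ψ + U ^ 2 * kform (fermiCurveMeasure (squareDispersion 1 0) μ) R ψ ≤
            (r.rhohi : ℝ) + U * ((r.c3B : ℝ) + r.tB) + U ^ 2 * ((r.c4B : ℝ) + C)) ∧
      (∀ U : ℝ, 0 < U → U ≤ r.U1 → ∀ χ : D4Irrep, χ ≠ D4Irrep.B1g →
        ∀ φ : Momentum → ℝ, IsChannelState (squareDispersion 1 0) μ χ φ →
          ∀ (R : Momentum → Momentum → ℝ) (C : ℝ),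
            -C ≤ kform (fermiCurveMeasure (squareDispersion 1 0) μ) R φ →
              ((r.chanOf χ).low : ℝ) - U * (((r.chanOf χ).s3 : ℝ) + (r.chanOf χ).t) -
                  U ^ 2 * (((r.chanOf χ).s4 : ℝ) + C) ≤
                resummedForm (squareDispersion 1 0) μ U φ +
                  U ^ 2 * kform (fermiCurveMeasure (squareDispersion 1 0) μ) R φ) := by
  obtain ⟨hrho, -, hU1, hlow⟩ := klto_dominates_spec r bx tab hdom
  obtain ⟨h3B, h3χ⟩ := h3
  set σ := fermiCurveMeasure (squareDispersion 1 0) μ with hσ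
  set Φ : Momentum → ℝ := bx.bB1g.trialFun tab with hΦ
  obtain ⟨c, hc2, hc2N, hstate, hmean, hform2⟩ := klto_b1g_ritz_state hμ bx.bB1g tab hritz hER
  refine ⟨fun k => c * Φ k, hstate, fun U hU hUU R C hRB => ?_, fun U hU hUU χ hχ φ hφ R C hRχ => ?_⟩
  · have h := h3B U hU hUU
    have hform3 : kform σ (klResummedKernel (squareDispersion 1 0) μ U) (fun k => c * Φ k) ≤
        ((r.c3B + r.tB : ℚ) : ℝ) + U * (r.c4B : ℝ) := by
      calc kform σ (klResummedKernel (squareDispersion 1 0) μ U) (fun k => c * Φ k)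
          = c ^ 2 * kform σ (klResummedKernel (squareDispersion 1 0) μ U) Φ := kform_smul σ _ Φ c
        _ ≤ c ^ 2 * ((((r.c3B + r.tB : ℚ) : ℝ) + U * (r.c4B : ℝ)) * ∫ k, Φ k ^ 2 ∂σ) := mul_le_mul_of_nonneg_left h hc2.le
        _ = (((r.c3B + r.tB : ℚ) : ℝ) + U * (r.c4B : ℝ)) * (c ^ 2 * ∫ k, Φ k ^ 2 ∂σ) := by ring
        _ = ((r.c3B + r.tB : ℚ) : ℝ) + U * (r.c4B : ℝ) := by rw [hc2N, mul_one]
    have hformR : kform σ R (fun k => c * Φ k) ≤ C := by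
      calc kform σ R (fun k => c * Φ k) = c ^ 2 * kform σ R Φ := kform_smul σ _ Φ c
        _ ≤ c ^ 2 * (C * ∫ k, Φ k ^ 2 ∂σ) := mul_le_mul_of_nonneg_left hRB hc2.le
        _ = C * (c ^ 2 * ∫ k, Φ k ^ 2 ∂σ) := by ring
        _ = C := by rw [hc2N, mul_one]
    unfold resummedForm
    rw [hmean]
    have h1 : ((bx.bB1g.rhohi : ℚ) : ℝ) ≤ r.rhohi := by exact_mod_cast hrho
    have h2 : U * kform σ (klResummedKernel (squareDispersion 1 0) μ U) (fun k => c * Φ k) ≤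
        U * (((r.c3B + r.tB : ℚ) : ℝ) + U * (r.c4B : ℝ)) := mul_le_mul_of_nonneg_left hform3 hU.le
    have h2R : U ^ 2 * kform σ R (fun k => c * Φ k) ≤ U ^ 2 * C :=
      mul_le_mul_of_nonneg_left hformR (sq_nonneg U)
    push_cast at h2
    have h0 : (0 : ℝ) ^ 2 / U = 0 := by simp
    nlinarith [hform2]
  · have hlo2 := klto_competitor_lower hμ χ (hlower χ hχ) φ hφ
    have hlo3 := h3χ χ hχ U hU hUU φ hφ
    have hlowq : (((r.chanOf χ).low : ℚ) : ℝ) ≤ ((bx.blk χ).lower tab χ : ℝ) := by exact_mod_cast hlow χ hχ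
    unfold resummedForm
    have hsq : (∫ k, φ k ∂σ) ^ 2 ≤ (∫ k, φ k ∂σ) ^ 2 / U := by
      rw [le_div_iff₀ hU]
      have hUle1 : U ≤ 1 := le_trans hUU (by exact_mod_cast hU1)
      have := sq_nonneg (∫ k, φ k ∂σ)
      nlinarith
    have h2 : U * -((((r.chanOf χ).s3 + (r.chanOf χ).t : ℚ) : ℝ) + U * ((r.chanOf χ).s4 : ℝ)) ≤
        U * kform σ (klResummedKernel (squareDispersion 1 0) μ U) φ := mul_le_mul_of_nonneg_left hlo3 hU.le
    have h2R : U ^ 2 * -C ≤ U ^ 2 * kform σ R φ := mul_le_mul_of_nonneg_left hRχ (sq_nonneg U)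
    push_cast at h2
    nlinarith

/-- **`B1g` selection to all orders for EVERY remainder constant `C ≥ C4`** (generic form, one box).  With `γ` any common lower bound of the
row's second-order gaps `low_χ - rhohi` (`χ ≠ B1g`): for every `0 < U ≤ r.U0`, every real `C ≥ r.C4` with `2 (C - C4) U² U0 ≤ (U0 - U) γ`, and
every kernel `R` with `⟨Φ_B, R Φ_B⟩ ≤ C ‖Φ_B‖²` on the record trial, the normalised `B1g` trial lies strictly below every normalised competitor
state `φ` with `⟨φ, R φ⟩ ≥ -C` in `resummedForm ε₀ μ U · + U² ⟨·, R ·⟩`. [cite: RaghuKivelsonScalapino2010, App. A] -/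
theorem klAllOrdersC_selection_of_lower {μ : ℝ} (hμ : μ ∈ Set.Ioo (-4 : ℝ) 0) (bx : KLBox) (tab : List KLTrig)
    (hritz : bx.bB1g.ritzOK tab D4Irrep.B1g = true) (hER : bx.bB1g.RitzEnclosure tab μ)
    (hlower : ∀ χ : D4Irrep, χ ≠ D4Irrep.B1g →
      (((bx.blk χ).lower tab χ : ℚ) : ℝ) ≤ channelInf (squareDispersion 1 0) μ 1 χ)
    (r : KLU0Row) (hr : r.ok = true) (hdom : r.dominates bx tab = true)
    (h3 : r.ResummedEnclosures μ (bx.bB1g.trialFun tab))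
    (γ : ℝ) (hγ : ∀ χ : D4Irrep, χ ≠ D4Irrep.B1g → γ ≤ ((r.chanOf χ).low : ℝ) - r.rhohi) :
    ∃ ψ : Momentum → ℝ, IsChannelState (squareDispersion 1 0) μ D4Irrep.B1g ψ ∧
      ∀ U : ℝ, 0 < U → U ≤ r.U0 → ∀ C : ℝ,
        2 * (C - r.C4) * U ^ 2 * r.U0 ≤ ((r.U0 : ℝ) - U) * γ →
        ∀ R : Momentum → Momentum → ℝ,
          kform (fermiCurveMeasure (squareDispersion 1 0) μ) R (bx.bB1g.trialFun tab) ≤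
              C * ∫ k, bx.bB1g.trialFun tab k ^ 2 ∂fermiCurveMeasure (squareDispersion 1 0) μ →
          ∀ χ : D4Irrep, χ ≠ D4Irrep.B1g →
            ∀ φ : Momentum → ℝ, IsChannelState (squareDispersion 1 0) μ χ φ →
              -C ≤ kform (fermiCurveMeasure (squareDispersion 1 0) μ) R φ →
              resummedForm (squareDispersion 1 0) μ U ψ + U ^ 2 * kform (fermiCurveMeasure (squareDispersion 1 0) μ) R ψ <
                resummedForm (squareDispersion 1 0) μ U φ + U ^ 2 * kform (fermiCurveMeasure (squareDispersion 1 0) μ) R φ := by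
  obtain ⟨-, hlen, -, -⟩ := klto_dominates_spec r bx tab hdom
  have hr' := hr
  simp only [KLU0Row.ok, Bool.and_eq_true, decide_eq_true_eq] at hr'
  obtain ⟨⟨⟨⟨-, hU01⟩, -⟩, -⟩, -⟩ := hr'
  obtain ⟨ψ, hψ, hup, hdown⟩ := klAllOrdersC_bounds hμ bx tab hritz hER hlower r hdom h3
  refine ⟨ψ, hψ, fun U hU hUU C hsmall R hRB χ hχ φ hφ hRχ => ?_⟩
  have hUU1 : U ≤ (r.U1 : ℝ) := le_trans hUU (by exact_mod_cast hU01)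
  have hU0U : 0 ≤ (r.U0 : ℝ) - U := sub_nonneg.mpr hUU
  have hsmallχ : 2 * (C - r.C4) * U ^ 2 * r.U0 ≤ ((r.U0 : ℝ) - U) * (((r.chanOf χ).low : ℝ) - r.rhohi) :=
    le_trans hsmall (mul_le_mul_of_nonneg_left (hγ χ hχ) hU0U)
  have hrow := klto_row_allOrders_of_C4_le r hr (r.chanOf χ) (klto_chanOf_mem r hlen χ hχ) C U hU hUU hsmallχ
  linarith [hup U hU hUU1 R C hRB, hdown U hU hUU1 χ hχ φ hφ R C hRχ]

/-- **`B1g` selection to all orders for every `C ≥ C4`, one box of a multiplicity-aware record (`basicOKB1gD`).**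
[cite: RaghuKivelsonScalapino2010, App. A] -/
theorem klAllOrdersC_selectionD {μ : ℝ} (hμ : μ ∈ Set.Ioo (-4 : ℝ) 0) (bx : KLBox) (tab : List KLTrig)
    (hB : bx.basicOKB1gD tab = true) (hER : bx.bB1g.RitzEnclosure tab μ)
    (hE : ∀ χ : D4Irrep, χ ≠ D4Irrep.B1g → (bx.blk χ).Enclosure tab μ χ)
    (r : KLU0Row) (hr : r.ok = true) (hdom : r.dominates bx tab = true)
    (h3 : r.ResummedEnclosures μ (bx.bB1g.trialFun tab))
    (γ : ℝ) (hγ : ∀ χ : D4Irrep, χ ≠ D4Irrep.B1g → γ ≤ ((r.chanOf χ).low : ℝ) - r.rhohi) :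
    ∃ ψ : Momentum → ℝ, IsChannelState (squareDispersion 1 0) μ D4Irrep.B1g ψ ∧
      ∀ U : ℝ, 0 < U → U ≤ r.U0 → ∀ C : ℝ,
        2 * (C - r.C4) * U ^ 2 * r.U0 ≤ ((r.U0 : ℝ) - U) * γ →
        ∀ R : Momentum → Momentum → ℝ,
          kform (fermiCurveMeasure (squareDispersion 1 0) μ) R (bx.bB1g.trialFun tab) ≤
              C * ∫ k, bx.bB1g.trialFun tab k ^ 2 ∂fermiCurveMeasure (squareDispersion 1 0) μ →
          ∀ χ : D4Irrep, χ ≠ D4Irrep.B1g →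
            ∀ φ : Momentum → ℝ, IsChannelState (squareDispersion 1 0) μ χ φ →
              -C ≤ kform (fermiCurveMeasure (squareDispersion 1 0) μ) R φ →
              resummedForm (squareDispersion 1 0) μ U ψ + U ^ 2 * kform (fermiCurveMeasure (squareDispersion 1 0) μ) R ψ <
                resummedForm (squareDispersion 1 0) μ U φ + U ^ 2 * kform (fermiCurveMeasure (squareDispersion 1 0) μ) R φ := by
  obtain ⟨hritz, hlower⟩ := klto_lower_of_basicOKB1gD hμ bx tab hB hE
  exact klAllOrdersC_selection_of_lower hμ bx tab hritz hER hlower r hr hdom h3 γ hγ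

/-! ### Generic window of rows -/

/-- The uniform gap of a list of window rows (kernel-decidable side condition `γ₀ ≤ low_χ - rhohi` on every row and competitor), read for
the competitor `χ ≠ B1g` of one row. [folklore] -/
theorem klWindowRows_gap (rows : List KLU0WinRow) (γ₀ : ℚ)
    (hgap : (rows.all fun w => w.row.chans.all fun c => decide (γ₀ ≤ c.low - w.row.rhohi)) = true)
    (w : KLU0WinRow) (hw : w ∈ rows) (hlen : w.row.chans.length = 4) (χ : D4Irrep) (hχ : χ ≠ D4Irrep.B1g) :
    ((γ₀ : ℚ) : ℝ) ≤ ((w.row.chanOf χ).low : ℝ) - w.row.rhohi := by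
  have h := List.all_eq_true.1 (List.all_eq_true.1 hgap w hw) (w.row.chanOf χ) (klto_chanOf_mem w.row hlen χ hχ)
  simp only [decide_eq_true_eq] at h
  exact_mod_cast h

/-- **`B1g` selection to ALL orders on a window of rows, for EVERY remainder constant `C ≥ C4₀`** (generic).  Rows passing
`klU0WinCheck mub mua u`, joined to records passing `checkB1gD` with their `EnclosuresB1g`, the named resummed window hypotheses, every row
carrying `C4 = C4₀` and `U1 = U1₀`, and the uniform gap `0 ≤ γ₀ ≤ low_χ - rhohi` on every row (kernel-decidable) ⟹ for every `μ ∈ [mub, mua]`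
some `B1g` channel state `ψ` on `F_μ` such that for every `0 < U ≤ u`, every real `C ≥ C4₀` with `2 (C - C4₀) U² u ≤ (u - U) γ₀`, and every kernel
`R` whose form is `≤ C ‖Φ_B‖²` on the `B1g` trial of every record box containing `μ` and `≥ -C` on the normalised competitor state at hand:
`resummedForm U ψ + U²⟨ψ, R ψ⟩ < resummedForm U φ + U²⟨φ, R φ⟩`.  The remainder bound is HYPOTHETICAL (displayed); its existence for some
finite `C` is the constructive programme's theorem; nothing here bounds a fourth-order diagram. [cite: RaghuKivelsonScalapino2010, App. A] -/
theorem klAllOrdersC_selection_windowRows (rows : List KLU0WinRow) (recs : List KLCert) (mub mua u C4₀ U1₀ γ₀ : ℚ)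
    (hcheck : klU0WinCheck mub mua u rows = true) (hjoin : klThirdOrderWindowJoin rows recs = true)
    (hrec : ∀ c ∈ recs, c.checkB1gD = true ∧ c.EnclosuresB1g)
    (h3 : KlResummedWindowEnclosures rows recs)
    (hconsts : (rows.all fun w => decide (w.row.C4 = C4₀) && decide (w.row.U1 = U1₀)) = true)
    (hγ₀ : 0 ≤ γ₀)
    (hgap : (rows.all fun w => w.row.chans.all fun c => decide (γ₀ ≤ c.low - w.row.rhohi)) = true) :
    ∀ μ : ℝ, ((mub : ℚ) : ℝ) ≤ μ → μ ≤ ((mua : ℚ) : ℝ) →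
      ∃ ψ : Momentum → ℝ, IsChannelState (squareDispersion 1 0) μ D4Irrep.B1g ψ ∧
        ∀ U : ℝ, 0 < U → U ≤ ((u : ℚ) : ℝ) → ∀ C : ℝ,
          2 * (C - ((C4₀ : ℚ) : ℝ)) * U ^ 2 * ((u : ℚ) : ℝ) ≤ (((u : ℚ) : ℝ) - U) * ((γ₀ : ℚ) : ℝ) →
          ∀ R : Momentum → Momentum → ℝ,
            (∀ c ∈ recs, ∀ bx ∈ c.boxes, ((bx.mulo : ℚ) : ℝ) ≤ μ → μ ≤ ((bx.muhi : ℚ) : ℝ) →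
              kform (fermiCurveMeasure (squareDispersion 1 0) μ) R (bx.bB1g.trialFun c.trials) ≤
                C * ∫ k, bx.bB1g.trialFun c.trials k ^ 2 ∂fermiCurveMeasure (squareDispersion 1 0) μ) →
            ∀ χ : D4Irrep, χ ≠ D4Irrep.B1g →
              ∀ φ : Momentum → ℝ, IsChannelState (squareDispersion 1 0) μ χ φ →
                -C ≤ kform (fermiCurveMeasure (squareDispersion 1 0) μ) R φ →
                resummedForm (squareDispersion 1 0) μ U ψ + U ^ 2 * kform (fermiCurveMeasure (squareDispersion 1 0) μ) R ψ <
                  resummedForm (squareDispersion 1 0) μ U φ + U ^ 2 * kform (fermiCurveMeasure (squareDispersion 1 0) μ) R φ := by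
  intro μ hμ₁ hμ₂
  obtain ⟨w, hw, c, hc, bx, hbx, hlo, hhi, hok, hu, hcl, hch, hdom, hBx, hμ, hER, hEχ⟩ :=
    klWindowRows_data rows recs mub mua u hcheck hjoin hrec μ hμ₁ hμ₂
  have h3w := h3 w hw c hc bx hbx hcl hch hdom μ hlo hhi
  obtain ⟨hC4, -⟩ := klWindowRows_consts rows C4₀ U1₀ hconsts w hw
  obtain ⟨-, hlen, -, -⟩ := klto_dominates_spec w.row bx c.trials hdom
  have hlo' : ((bx.mulo : ℚ) : ℝ) ≤ μ := le_trans (by exact_mod_cast hcl) hlo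
  have hhi' : μ ≤ ((bx.muhi : ℚ) : ℝ) := le_trans hhi (by exact_mod_cast hch)
  obtain ⟨hupos, -⟩ := klU0Win_cover mub mua u rows hcheck
  obtain ⟨ψ, hψ, hsel⟩ := klAllOrdersC_selectionD hμ bx c.trials hBx hER hEχ w.row hok hdom h3w ((γ₀ : ℚ) : ℝ)
    (fun χ hχ => klWindowRows_gap rows γ₀ hgap w hw hlen χ hχ)
  refine ⟨ψ, hψ, fun U hU hUu C hsmall R hRB χ hχ φ hφ hRχ => ?_⟩
  have hsmall' : 2 * (C - (w.row.C4 : ℝ)) * U ^ 2 * (w.row.U0 : ℝ) ≤ ((w.row.U0 : ℝ) - U) * ((γ₀ : ℚ) : ℝ) := by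
    rw [hC4]
    exact klU0_smallness_mono hU.le hUu (by exact_mod_cast hupos) (by exact_mod_cast hu) (by exact_mod_cast hγ₀) le_rfl hsmall
  exact hsel U hU (le_trans hUu (by exact_mod_cast hu)) C hsmall' R (hRB c hc bx hbx hlo' hhi') χ hχ φ hφ hRχ

/-- **The halved form**: as `klAllOrdersC_selection_windowRows`, for every `0 < U` with `2U ≤ u` and `4 (C - C4₀) U² ≤ γ₀` — i.e.
`U ≤ min (u/2, ½ √(γ₀/(C - C4₀)))`: an explicit positive threshold for EVERY remainder constant. [cite: RaghuKivelsonScalapino2010, App. A] -/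
theorem klAllOrdersC_selection_windowRows_half (rows : List KLU0WinRow) (recs : List KLCert) (mub mua u C4₀ U1₀ γ₀ : ℚ)
    (hcheck : klU0WinCheck mub mua u rows = true) (hjoin : klThirdOrderWindowJoin rows recs = true)
    (hrec : ∀ c ∈ recs, c.checkB1gD = true ∧ c.EnclosuresB1g)
    (h3 : KlResummedWindowEnclosures rows recs)
    (hconsts : (rows.all fun w => decide (w.row.C4 = C4₀) && decide (w.row.U1 = U1₀)) = true)
    (hγ₀ : 0 ≤ γ₀)
    (hgap : (rows.all fun w => w.row.chans.all fun c => decide (γ₀ ≤ c.low - w.row.rhohi)) = true) :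
    ∀ μ : ℝ, ((mub : ℚ) : ℝ) ≤ μ → μ ≤ ((mua : ℚ) : ℝ) →
      ∃ ψ : Momentum → ℝ, IsChannelState (squareDispersion 1 0) μ D4Irrep.B1g ψ ∧
        ∀ U : ℝ, 0 < U → 2 * U ≤ ((u : ℚ) : ℝ) → ∀ C : ℝ,
          4 * (C - ((C4₀ : ℚ) : ℝ)) * U ^ 2 ≤ ((γ₀ : ℚ) : ℝ) →
          ∀ R : Momentum → Momentum → ℝ,
            (∀ c ∈ recs, ∀ bx ∈ c.boxes, ((bx.mulo : ℚ) : ℝ) ≤ μ → μ ≤ ((bx.muhi : ℚ) : ℝ) →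
              kform (fermiCurveMeasure (squareDispersion 1 0) μ) R (bx.bB1g.trialFun c.trials) ≤
                C * ∫ k, bx.bB1g.trialFun c.trials k ^ 2 ∂fermiCurveMeasure (squareDispersion 1 0) μ) →
            ∀ χ : D4Irrep, χ ≠ D4Irrep.B1g →
              ∀ φ : Momentum → ℝ, IsChannelState (squareDispersion 1 0) μ χ φ →
                -C ≤ kform (fermiCurveMeasure (squareDispersion 1 0) μ) R φ →
                resummedForm (squareDispersion 1 0) μ U ψ + U ^ 2 * kform (fermiCurveMeasure (squareDispersion 1 0) μ) R ψ <
                  resummedForm (squareDispersion 1 0) μ U φ + U ^ 2 * kform (fermiCurveMeasure (squareDispersion 1 0) μ) R φ := by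
  intro μ hμ₁ hμ₂
  obtain ⟨ψ, hψ, hsel⟩ :=
    klAllOrdersC_selection_windowRows rows recs mub mua u C4₀ U1₀ γ₀ hcheck hjoin hrec h3 hconsts hγ₀ hgap μ hμ₁ hμ₂
  refine ⟨ψ, hψ, fun U hU h2U C h4 R hRB χ hχ φ hφ hRχ => ?_⟩
  exact hsel U hU (by linarith) C (klU0_smallness_of_half hU.le h2U (by exact_mod_cast hγ₀) h4) R hRB χ hχ φ hφ hRχ

end Summit.HubbardSuperconductivity.HubbardSuperconductivity.Theorems

end
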